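import Summits.BirchSwinnertonDyer.BirchSwinnertonDyer.Theorems.ManinLocalTwoThreeShimuraKernelEisenstein
import Summits.BirchSwinnertonDyer.BirchSwinnertonDyer.Theorems.ManinLocalTwoThreeShimuraQuotientFrickeParity
import Literature.NumberTheory.EllipticCurves.CuspFormLFunctionLevelConductorProofs
import HarnessLib

/-!
# THE `U_q` CONGRUENCE OF THE SHIMURA QUOTIENT (unconditional): `U_q f = a_q f`, `q ∣ N` ⟹ `(a_q − q)·Λ₀(f) ⊆ Λ₁(f)`; at `9 ∣ N` a Shimura `3`-kernel forces `a_q(W) ≡ q (mod 3)` for every prime `q ∣ N`, hence `N/3^{v₃(N)}` SQUAREFREE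
(route `ManinLocalTwoThree`, crux C3 `ManinPrimeToThreeAtNine` stmt-BirchSwinnertonDyer-22968; cell bsd-f2-manin, C3 LEAD p1 gen 17;
`--supports stmt-BirchSwinnertonDyer-22968`; node E-an-221 — seventh habitat file, sequel to `…ShimuraKernelEisenstein`)

For a prime `q ∣ N` the Hecke operator is `U_q` (`modularSymbol_heckeT_eq_sum`, no diagonal term): `a_q·{∞, a/c}_f = ∑_{j mod q} {∞, (a + jc)/(qc)}_f`,
and since `q ∣ N ∣ c` EVERY term is the period of `Gamma0.mkOfCol (a + jc, qc)`, whose lower-right entry is `≡ (a + jc)⁻¹ ≡ a⁻¹ ≡ d (mod N)`: all `q` terms lie in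
the class of `{∞, γ∞}` modulo `Λ₁(f)`.  Hence (arithmetic shadow: `U_q` acts on `Σ(N)` by `q`):
* §1 **`sub_mul_cuspSymbol_mem_periodLatticeGamma1_of_heckeU`** / `sub_mul_mem_periodLatticeGamma1_of_heckeU` — `(a_q − q)·Λ₀(f) ⊆ Λ₁(f)` (UNCONDITIONAL; for
  `q = 3`, `9 ∣ N`, `a₃ = 0` this is the tree's traceless inclusion `3Λ₀ ⊆ Λ₁`);
* §2 at `9 ∣ N` under `KummerShimura D u`: **`three_dvd_lFunction_sub_self_of_kummerShimura`** — `3 ∣ a_q(W) − q` for every prime `q ∣ N`; with the tree's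
  `a_q = 0` at `q² ∣ N` (`IsNewform0.cuspCoeff_eq_zero_of_sq_dvd`): **`eq_three_of_sq_dvd_of_kummerShimura` — every prime whose square divides `N` is `3`**
  (the prime-to-3 part of `N` is SQUAREFREE: no other additive prime), and **E-an-221 holds outright whenever some `q ≠ 3` has `q² ∣ N`**
  (`…_of_sq_dvd`).  For `q ∥ N` (multiplicative) `a_q = ±1`, so `a_q ≡ q (mod 3)` reads: `q ≡ 1 (3) ⟹ a_q = +1` (split, `w_q = −1`), `q ≡ 2 (3) ⟹ a_q = −1`
  (non-split, `w_q = +1`) — with the Atkin–Lehner sign pattern (p742140: exactly one minus prime power) the prime-to-3 part of `N` has AT MOST ONE prime `≡ 1 (mod 3)`.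

NET HABITAT OF E-an-221 after the seven files (all unconditional): `N = 3^k·M`, `k ≥ 2`, `M` squarefree prime to 3 with at most one prime factor `q₁ ≡ 1 (mod 3)`;
root number `+1`; `a_p ≡ 1 + p (mod 3)` for `p ∤ N` and `a_q ≡ q (mod 3)` for `q ∣ M`; the unique Atkin–Lehner minus prime power is `q₁` if present (then `w_{3^k} = +1`),
else `3^k` with `k ≥ 3`; `3 ∣ φ(N/3)`; kernel `Λ₁(f) = ℤ·(3u/c) + 3Λ₀(f)`, the imaginary third-period line.  Data: 27a1 (`N = 3³`), 54a1 (`N = 2·3³`, `a₂ = −1 ≡ 2` ✓).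

HONEST FRAMING.  Unconditional theorems about the tree's period lattices; E-an-221 on its habitat, RES₃♭, C3, Manin's conjecture and BSD are NOT proved.  No definitions,
no named facts, no sorry.
[cite: CremonaAlgorithms1997, §2.4 (2.4.1)–(2.4.2)] [cite: LingOesterle1991, §1, Thm. 1 and Thm. 6 (shape: U_q on Σ(N))] [cite: DiamondShurman2005, Prop. 5.8.5]
-/

set_option autoImplicit false
-- lint-debt: the directory name repeats the summit name (sibling precedent `ManinLocalTwoThreeShimuraKernelEisenstein.lean`)
set_option linter.dupNamespace false

noncomputable section

open scoped Classical ComplexConjugate MatrixGroups ModularForm PeriodPair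
open CongruenceSubgroup Complex
open WeierstrassCurve Literature.NumberTheory.EllipticCurves Literature.NumberTheory.EllipticCurves.ModularForms
open Summit.BirchSwinnertonDyer.Rank1Residual.ManinAdditive.CuspidalKummer
open Summit.BirchSwinnertonDyer.Rank1Residual.ManinAdditive.CuspidalKummerThree
open Summit.BirchSwinnertonDyer.Rank1Residual.ManinAdditive.UDCKummerLine
open Summit.BirchSwinnertonDyer.Rank1Residual.ManinAdditive.UDCKummerLineK
open Summit.BirchSwinnertonDyer.Rank1Residual.ManinAdditive.ShimuraThreeTorsion

namespace Summit.BirchSwinnertonDyer.BirchSwinnertonDyer.Theorems.ManinLocalTwoThree.SigmaHabitat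

/-! ## §1 `(a_q − q)·Λ₀(f) ⊆ Λ₁(f)` for `q ∣ N` -/

section HeckeU

variable {N : ℕ} [NeZero N] (f : CuspForm (Gamma0 N) 2)

/-- **THE `U_q` CONGRUENCE (core; UNCONDITIONAL).**  `U_q f = a_q f` with `a_q ∈ ℤ`, `q ∣ N` prime, `γ ∈ Γ₀(N)` with `c ≠ 0` ⟹ `(a_q − q)·{∞, γ∞}_f ∈ Λ₁(f)`.
[cite: CremonaAlgorithms1997, §2.4 (2.4.1)] -/
theorem sub_mul_cuspSymbol_mem_periodLatticeGamma1_of_heckeU {q : ℕ} [Fact q.Prime] (hqN : q ∣ N) {aq : ℤ}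
    (hT : heckeT (Gamma0 N) 2 q f = (aq : ℂ) • f) (γ : Gamma0 N) (hc : ((γ : SL(2, ℤ)) 1 0 : ℤ) ≠ 0) :
    ((aq : ℂ) - q) * cuspSymbol f γ ∈ periodLatticeGamma1 f := by
  have hq : q.Prime := Fact.out
  have hq0 : q ≠ 0 := hq.ne_zero
  set a : ℤ := (γ : SL(2, ℤ)) 0 0 with ha
  set c : ℤ := (γ : SL(2, ℤ)) 1 0 with hcc
  set d : ℤ := (γ : SL(2, ℤ)) 1 1 with hdd
  have hac : IsCoprime a c := Matrix.SpecialLinearGroup.isCoprime_col (γ : SL(2, ℤ)) 0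
  have hNc : (N : ℤ) ∣ c := dvd_entry_of_mem_Gamma0 N γ.2
  have hqc : (q : ℤ) ∣ c := (Int.natCast_dvd_natCast.mpr hqN).trans hNc
  have hcN : ((c : ℤ) : ZMod N) = 0 := (ZMod.intCast_zmod_eq_zero_iff_dvd c N).mpr hNc
  have had : ((a : ℤ) : ZMod N) * ((d : ℤ) : ZMod N) = 1 := cast_apply_zero_zero_mul_apply_one_one γ
  have hc' : (c : ℚ) ≠ 0 := by exact_mod_cast hc
  have hq' : (q : ℚ) ≠ 0 := by exact_mod_cast hq0
  set s : ℂ := cuspSymbol f γ with hs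
  have hsγ : s = modularSymbol f ((a : ℚ) / c) := by rw [hs, cuspSymbol, if_neg hc]
  have hH := modularSymbol_heckeT_eq_sum q f hq ((a : ℚ) / c)
  rw [hT, modularSymbol_const_smul, if_pos hqN, add_zero] at hH
  -- every term is in the class of `s`
  set m : Fin q → ℂ := fun j ↦ modularSymbol f (((a : ℚ) / c + (((j : ℕ) : ℤ) : ℚ)) / q) with hm
  have hgen : ∀ j : Fin q, m j - s ∈ periodLatticeGamma1 f := by
    intro j
    have hajc : IsCoprime (a + ((j : ℕ) : ℤ) * c) c := by simpa [mul_comm] using hac.add_mul_right_left ((j : ℕ) : ℤ)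
    have hcop : IsCoprime (a + ((j : ℕ) : ℤ) * c) ((q : ℤ) * c) := (hajc.of_isCoprime_of_dvd_right hqc).mul_right hajc
    set δ : Gamma0 N := Gamma0.mkOfCol (a + ((j : ℕ) : ℤ) * c) ((q : ℤ) * c) hcop (hNc.mul_left _) with hδ
    have hδ00 : ((δ : SL(2, ℤ)) 0 0 : ℤ) = a + ((j : ℕ) : ℤ) * c := Gamma0.mkOfCol_apply_zero_zero _ _ _ _
    have hδ10 : ((δ : SL(2, ℤ)) 1 0 : ℤ) = q * c := Gamma0.mkOfCol_apply_one_zero _ _ _ _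
    have hqc0 : (q : ℤ) * c ≠ 0 := mul_ne_zero (by exact_mod_cast hq0) hc
    have hsj : cuspSymbol f δ = m j := by
      rw [hm, cuspSymbol, if_neg (by rw [hδ10]; exact hqc0), hδ00, hδ10]
      dsimp only
      congr 1; push_cast; field_simp
    have hmod : ((((γ : SL(2, ℤ)) 1 1 : ℤ)) : ZMod N) = (((δ : SL(2, ℤ)) 1 1 : ℤ) : ZMod N) := by
      have h := cast_apply_zero_zero_mul_apply_one_one δ
      rw [hδ00] at h
      push_cast at h
      rw [hcN, mul_zero, add_zero] at h
      rw [← hdd]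
      linear_combination (((δ : SL(2, ℤ)) 1 1 : ℤ) : ZMod N) * had - ((d : ℤ) : ZMod N) * h
    rw [← hsj]
    exact cuspSymbol_sub_mem_periodLatticeGamma1_of_apply_eq f γ δ hmod
  have e : ((aq : ℂ) - q) * s = ∑ j : Fin q, (m j - s) := by
    rw [Finset.sum_sub_distrib, Finset.sum_const, Finset.card_univ, Fintype.card_fin, nsmul_eq_mul]
    linear_combination (aq : ℂ) * hsγ + hH
  rw [e]
  exact sum_mem fun j _ ↦ hgen j

/-- **`(a_q − q)·Λ₀(f) ⊆ Λ₁(f)`** for `U_q f = a_q f`, `a_q ∈ ℤ`, `q ∣ N` prime (every `γ`; a period with `c = 0` is `0`). [cite: CremonaAlgorithms1997, §2.4 (2.4.1)] -/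
theorem sub_mul_mem_periodLatticeGamma1_of_heckeU {q : ℕ} [Fact q.Prime] (hqN : q ∣ N) {aq : ℤ}
    (hT : heckeT (Gamma0 N) 2 q f = (aq : ℂ) • f) {z : ℂ} (hz : z ∈ periodLattice f) :
    ((aq : ℂ) - q) * z ∈ periodLatticeGamma1 f := by
  have hz' : z ∈ (periodLattice f : Set ℂ) := hz
  rw [coe_periodLattice_eq_range] at hz'
  obtain ⟨γ, rfl⟩ := hz'
  by_cases hc : ((γ : SL(2, ℤ)) 1 0 : ℤ) = 0
  · rw [cuspSymbol, if_pos hc, mul_zero]; exact zero_mem _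
  · exact sub_mul_cuspSymbol_mem_periodLatticeGamma1_of_heckeU f hqN hT γ hc

end HeckeU

/-! ## §2 At `9 ∣ N`: `a_q(W) ≡ q (mod 3)` for `q ∣ N`; the prime-to-`3` part of `N` is squarefree -/

section Nine

variable {W : WeierstrassCurve ℚ} {N : ℕ} [NeZero N]

/-- **A Shimura third-period forces `3 ∣ a_q(W) − q` for every prime `q ∣ N`** (`9 ∣ N`, lattice-optimal; UNCONDITIONAL). [cite: LingOesterle1991, Thm. 6 (shape: U_q on Σ(N))] -/
theorem three_dvd_lFunction_sub_self_of_kummerShimura (D : ModularParametrizationData W N)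
    (hopt : ∀ z ∈ D.L.lattice, ∃ w ∈ periodLattice D.f, z = D.c * w) (h9 : 3 ^ 2 ∣ N)
    {u : ℂ} (hu₂ : 3 * u ∈ D.L.lattice) (hS : KummerShimura D u)
    {q : ℕ} [Fact q.Prime] (hqN : q ∣ N) : (3 : ℤ) ∣ W.LFunction q - q := by
  by_contra h3
  apply not_kummerShimura_of_periodLatticeGamma1_eq D hopt _ hu₂ hS
  have hcop : IsCoprime (3 : ℤ) (W.LFunction q - q) :=
    (Int.isCoprime_iff_gcd_eq_one.mpr (by
      have h1 := Int.gcd_dvd_left 3 (W.LFunction q - q)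
      have h2 := Int.gcd_dvd_right 3 (W.LFunction q - q)
      rcases (Nat.dvd_prime Nat.prime_three).mp (by exact_mod_cast h1) with h | h
      · exact h
      · exfalso; apply h3; rw [h] at h2; exact_mod_cast h2))
  obtain ⟨α, β, hαβ⟩ := hcop
  refine le_antisymm (periodLatticeGamma1_le_periodLattice D.f) fun z hz ↦ ?_
  have hA := three_mul_mem_periodLatticeGamma1_of_nine_dvd D h9 hz
  have hB := sub_mul_mem_periodLatticeGamma1_of_heckeU D.f hqN (heckeT_eq_lFunction_smul D) hz
  have h1 : ((α * 3 + β * (W.LFunction q - q) : ℤ) : ℂ) = 1 := by rw [hαβ]; simp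
  push_cast at h1
  have key : z = (α : ℂ) * (3 * z) + (β : ℂ) * ((((W.LFunction q : ℤ) : ℂ) - q) * z) := by
    linear_combination -z * h1
  rw [key]
  have ha := (periodLatticeGamma1 D.f).zsmul_mem hA α
  have hb := (periodLatticeGamma1 D.f).zsmul_mem hB β
  rw [zsmul_eq_mul] at ha hb
  exact add_mem ha hb

/-- **A Shimura third-period forbids a second additive prime: `q² ∣ N`, `q` prime ⟹ `q = 3`** (`9 ∣ N`, lattice-optimal; `a_q = 0` at `q² ∣ N` and
`3 ∣ a_q − q`).  So on E-an-221's habitat the prime-to-`3` part of `N` is SQUAREFREE.  UNCONDITIONAL. [cite: LingOesterle1991, Thm. 6 (shape)] -/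
theorem eq_three_of_sq_dvd_of_kummerShimura (D : ModularParametrizationData W N)
    (hopt : ∀ z ∈ D.L.lattice, ∃ w ∈ periodLattice D.f, z = D.c * w) (h9 : 3 ^ 2 ∣ N)
    {u : ℂ} (hu₂ : 3 * u ∈ D.L.lattice) (hS : KummerShimura D u)
    {q : ℕ} (hq : q.Prime) (hq2 : q ^ 2 ∣ N) : q = 3 := by
  haveI : Fact q.Prime := ⟨hq⟩
  have hqN : q ∣ N := (dvd_pow_self q two_ne_zero).trans hq2
  have h3 := three_dvd_lFunction_sub_self_of_kummerShimura D hopt h9 hu₂ hS hqN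
  have h0 : (W.LFunction q : ℤ) = 0 := by
    have h := D.isNewformOf.2 q
    rw [D.isNewformOf.1.cuspCoeff_eq_zero_of_sq_dvd hq hq2] at h
    exact_mod_cast h.symm
  rw [h0, zero_sub, dvd_neg] at h3
  have h3' : 3 ∣ q := by exact_mod_cast h3
  exact ((Nat.dvd_prime hq).mp h3').resolve_left (by norm_num) |>.symm

/-- **E-an-221 HOLDS OUTRIGHT whenever some prime `q ≠ 3` has `q² ∣ N`** (vacuously: no Shimura third-period there). [cite: LingOesterle1991, Thm. 6 (shape)] -/
theorem shimuraThreeKernelForcesRationalThreeTorsionAtNine_of_sq_dvd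
    (W : WeierstrassCurve ℚ) [W.IsElliptic] [W.IsGloballyMinimal] {N : ℕ} [NeZero N]
    (D : ModularParametrizationData W N)
    (hopt : ∀ z ∈ D.L.lattice, ∃ w ∈ periodLattice D.f, z = D.c * w) (h9 : 3 ^ 2 ∣ N)
    {q : ℕ} (hq : q.Prime) (hq3 : q ≠ 3) (hq2 : q ^ 2 ∣ N)
    (u : ℂ) (hu₂ : 3 * u ∈ D.L.lattice) (hS : KummerShimura D u) : ∃ X Y : ℚ, IsShortThreeTorsion W D.c X Y :=
  absurd (eq_three_of_sq_dvd_of_kummerShimura D hopt h9 hu₂ hS hq hq2) hq3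

/-- **THE STUB CUT: E-an-221 ⟸ E-an-221♮**, where E-an-221♮ is E-an-221 restricted to levels whose prime-to-3 part is squarefree (`∀ q prime, q² ∣ N → q = 3`),
with `frickeEigenvalue f = −1`, `3 ∣ φ(N/3)`, the Eisenstein congruences `3 ∣ a_p − p − 1` (`p ∤ N`) and `3 ∣ a_q − q` (`q ∣ N`), and the pinned kernel
(`Λ₁(f) = ℤ·(3u/c) + 3Λ₀(f)`, `ū + u ∈ Λ_E`). [cite: LingOesterle1991, Thm. 1 and Thm. 6 (shape)] -/
theorem shimuraThreeKernelForcesRationalThreeTorsionAtNine_of_squarefreeHabitat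
    (h : ∀ (W : WeierstrassCurve ℚ) [W.IsElliptic] [W.IsGloballyMinimal] {N : ℕ} [NeZero N]
      (D : ModularParametrizationData W N),
      (∀ z ∈ D.L.lattice, ∃ w ∈ periodLattice D.f, z = D.c * w) → 3 ^ 2 ∣ N →
      (∀ q : ℕ, q.Prime → q ^ 2 ∣ N → q = 3) → frickeEigenvalue D.f = -1 → 3 ∣ Nat.totient (N / 3) →
      (∀ p : ℕ, p.Prime → ¬ p ∣ N → (3 : ℤ) ∣ W.LFunction p - p - 1) →
      (∀ q : ℕ, q.Prime → q ∣ N → (3 : ℤ) ∣ W.LFunction q - q) →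
      ∀ u : ℂ, 3 * u ∈ D.L.lattice →
      (∀ z : ℂ, z ∈ periodLatticeGamma1 D.f ↔ ∃ k : ℤ, ∃ v ∈ periodLattice D.f, z = k * (3 * u / D.c) + 3 * v) →
      conj u + u ∈ D.L.lattice →
      ∃ X Y : ℚ, IsShortThreeTorsion W D.c X Y) :
    ShimuraThreeKernelForcesRationalThreeTorsionAtNine :=
  fun W _ _ _ _ D hopt h9 u _ hu₂ hS ↦
    h W D hopt h9 (fun _ hq hq2 ↦ eq_three_of_sq_dvd_of_kummerShimura D hopt h9 hu₂ hS hq hq2)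
      (frickeEigenvalue_eq_neg_one_of_kummerShimura D hopt h9 hu₂ hS)
      (three_dvd_totient_div_three_of_kummerShimura D hopt h9 hu₂ hS)
      (fun p hp hpN ↦ by haveI : Fact p.Prime := ⟨hp⟩; exact three_dvd_lFunction_sub_of_kummerShimura D hopt h9 hu₂ hS hpN)
      (fun q hq hqN ↦ by haveI : Fact q.Prime := ⟨hq⟩; exact three_dvd_lFunction_sub_self_of_kummerShimura D hopt h9 hu₂ hS hqN)
      u hu₂ (mem_periodLatticeGamma1_iff_of_kummerShimura D hopt h9 hu₂ hS) (conj_add_self_mem_lattice_of_kummerShimura D hopt h9 hu₂ hS)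

end Nine

end Summit.BirchSwinnertonDyer.BirchSwinnertonDyer.Theorems.ManinLocalTwoThree.SigmaHabitat

end
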